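import Summits.BirchSwinnertonDyer.BirchSwinnertonDyer.Theorems.ClassRecordThreeEulerHalvesAtThreeCartanCorrespondenceCubicSum
import HarnessLib

/-!
# The cubic class-count law decided for every prime `q ≡ 1 (3)` up to `157`

Helper file riding `--supports stmt-BirchSwinnertonDyer-19109` (crux `EulerHalvesAtThree`; UNREGISTERED sub-line
`Cruxes/EulerHalvesAtThree/Lines/cartan_corr`, seat `bsd-idea-10` g12); companion of `…CubicSumRegimes.lean`. Eleven more kernel-decided
rungs of `CubicClassCountLawAtThree` (the CubicSum file has `7, 13, 19, 31, 37, 43`): the primes `q ≡ 1 (3)` in `(43, 157]`, i.e.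
`61, 67, 73, 79, 97, 103, 109, 127, 139, 151, 157` — among them `q = 73 ≡ 1 (9)`, the `2`-cube primes `109, 127, 157`, and **`q = 109`,
the first prime of the residual class `R`** (`q ≡ 1 (27)`, `2` a cube) where neither the `β = 0` family nor the second-moment sieve
decides the law. Each rung: a witness `(ζ, x²+x+c)` with `|Σ|² = 3m`, `3 ∤ m`, by `decide`. HONEST FRAMING: finitely many `q` only; the law
for all `q` stays OPEN (in `R`); no crux ∕ route item ∕ registered stub is proved; BSD is proved for no curve. [folklore]
-/

set_option linter.dupNamespace false
set_option autoImplicit false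

namespace Summit.BirchSwinnertonDyer.BirchSwinnertonDyer.Theorems.CartanCorrespondence

open Summit.BirchSwinnertonDyer.BirchSwinnertonDyer.Theorems.CartanDegree
open Summit.BirchSwinnertonDyer.BirchSwinnertonDyer.Theorems.CartanTorusCubeCut

/-! ## PROVED: the count law for every prime `q ≡ 1 (3)` up to `157` (kernel `decide`), including `q = 109 ∈ R` -/

/-- PROVED: `ord₃(3·m) = 1` for `m` prime to `3`. [folklore] -/
theorem padicValInt_three_mul_natCast {m : ℕ} (hm : m ≠ 0) (h3 : ¬ 3 ∣ m) : padicValInt 3 (3 * (m : ℤ)) = 1 := by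
  haveI : Fact (Nat.Prime 3) := ⟨Nat.prime_three⟩
  rw [padicValInt.mul (by norm_num) (by exact_mod_cast hm), padicValInt_three_three, padicValInt.of_nat,
    padicValNat.eq_zero_of_not_dvd h3]

set_option maxRecDepth 40000 in
/-- PROVED (rung, `q = 61`): `ζ = 47`, `x² + x + 6`, counts `(20,12,28)`, `|Σ|² = 192 = 3·64`. [folklore] -/
theorem cubicClassCountLaw_61 : ∃ ζ b c : ZMod 61, ζ ^ 3 = 1 ∧ ζ ≠ 1 ∧ (∀ x : ZMod 61, x ^ 2 + b * x + c ≠ 0) ∧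
    padicValInt 3 (cubicSumNorm 61 ζ 1 b c) = 1 :=
  ⟨47, 1, 6, by decide, by decide, by decide, by
    rw [show cubicSumNorm 61 47 1 1 6 = 3 * ((64 : ℕ) : ℤ) by decide]; exact padicValInt_three_mul_natCast (by norm_num) (by norm_num)⟩

set_option maxRecDepth 40000 in
/-- PROVED (rung, `q = 67`): `ζ = 37`, `x² + x + 4`, counts `(22,24,20)`, `|Σ|² = 12`. [folklore] -/
theorem cubicClassCountLaw_67 : ∃ ζ b c : ZMod 67, ζ ^ 3 = 1 ∧ ζ ≠ 1 ∧ (∀ x : ZMod 67, x ^ 2 + b * x + c ≠ 0) ∧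
    padicValInt 3 (cubicSumNorm 67 ζ 1 b c) = 1 :=
  ⟨37, 1, 4, by decide, by decide, by decide, by
    rw [show cubicSumNorm 67 37 1 1 4 = 3 * ((4 : ℕ) : ℤ) by decide]; exact padicValInt_three_mul_natCast (by norm_num) (by norm_num)⟩

set_option maxRecDepth 40000 in
/-- PROVED (rung, `q = 73 ≡ 1 (9)`): `ζ = 64`, `x² + x + 2`, counts `(24,28,20)`, `|Σ|² = 48`. [folklore] -/
theorem cubicClassCountLaw_73 : ∃ ζ b c : ZMod 73, ζ ^ 3 = 1 ∧ ζ ≠ 1 ∧ (∀ x : ZMod 73, x ^ 2 + b * x + c ≠ 0) ∧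
    padicValInt 3 (cubicSumNorm 73 ζ 1 b c) = 1 :=
  ⟨64, 1, 2, by decide, by decide, by decide, by
    rw [show cubicSumNorm 73 64 1 1 2 = 3 * ((16 : ℕ) : ℤ) by decide]; exact padicValInt_three_mul_natCast (by norm_num) (by norm_num)⟩

set_option maxRecDepth 40000 in
/-- PROVED (rung, `q = 79`): `ζ = 23`, `x² + x + 3`, counts `(18,26,34)`, `|Σ|² = 192`. [folklore] -/
theorem cubicClassCountLaw_79 : ∃ ζ b c : ZMod 79, ζ ^ 3 = 1 ∧ ζ ≠ 1 ∧ (∀ x : ZMod 79, x ^ 2 + b * x + c ≠ 0) ∧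
    padicValInt 3 (cubicSumNorm 79 ζ 1 b c) = 1 :=
  ⟨23, 1, 3, by decide, by decide, by decide, by
    rw [show cubicSumNorm 79 23 1 1 3 = 3 * ((64 : ℕ) : ℤ) by decide]; exact padicValInt_three_mul_natCast (by norm_num) (by norm_num)⟩

set_option maxRecDepth 40000 in
/-- PROVED (rung, `q = 97`): `ζ = 35`, `x² + x + 5`, counts `(32,42,22)`, `|Σ|² = 300`. [folklore] -/
theorem cubicClassCountLaw_97 : ∃ ζ b c : ZMod 97, ζ ^ 3 = 1 ∧ ζ ≠ 1 ∧ (∀ x : ZMod 97, x ^ 2 + b * x + c ≠ 0) ∧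
    padicValInt 3 (cubicSumNorm 97 ζ 1 b c) = 1 :=
  ⟨35, 1, 5, by decide, by decide, by decide, by
    rw [show cubicSumNorm 97 35 1 1 5 = 3 * ((100 : ℕ) : ℤ) by decide]; exact padicValInt_three_mul_natCast (by norm_num) (by norm_num)⟩

set_option maxRecDepth 40000 in
/-- PROVED (rung, `q = 103`): `ζ = 46`, `x² + x + 2`, counts `(32,34,36)`, `|Σ|² = 12`. [folklore] -/
theorem cubicClassCountLaw_103 : ∃ ζ b c : ZMod 103, ζ ^ 3 = 1 ∧ ζ ≠ 1 ∧ (∀ x : ZMod 103, x ^ 2 + b * x + c ≠ 0) ∧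
    padicValInt 3 (cubicSumNorm 103 ζ 1 b c) = 1 :=
  ⟨46, 1, 2, by decide, by decide, by decide, by
    rw [show cubicSumNorm 103 46 1 1 2 = 3 * ((4 : ℕ) : ℤ) by decide]; exact padicValInt_three_mul_natCast (by norm_num) (by norm_num)⟩

set_option maxRecDepth 40000 in
/-- PROVED (rung, `q = 109` — the FIRST PRIME OF THE RESIDUAL CLASS `R`: `q ≡ 1 (27)` and `2` a cube mod `109`, so the `β = 0` family fails
there (`ord₃|Σ_{x²+γ}|² = 3`) and the sieve is silent): `ζ = 63`, `x² + x + 3`, counts `(28,36,44)`, `|Σ|² = 192`. [folklore] -/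
theorem cubicClassCountLaw_109 : ∃ ζ b c : ZMod 109, ζ ^ 3 = 1 ∧ ζ ≠ 1 ∧ (∀ x : ZMod 109, x ^ 2 + b * x + c ≠ 0) ∧
    padicValInt 3 (cubicSumNorm 109 ζ 1 b c) = 1 :=
  ⟨63, 1, 3, by decide, by decide, by decide, by
    rw [show cubicSumNorm 109 63 1 1 3 = 3 * ((64 : ℕ) : ℤ) by decide]; exact padicValInt_three_mul_natCast (by norm_num) (by norm_num)⟩

set_option maxRecDepth 40000 in
/-- PROVED (rung, `q = 127`, `2` a cube): `ζ = 107`, `x² + x + 3`, counts `(40,42,44)`, `|Σ|² = 12`. [folklore] -/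
theorem cubicClassCountLaw_127 : ∃ ζ b c : ZMod 127, ζ ^ 3 = 1 ∧ ζ ≠ 1 ∧ (∀ x : ZMod 127, x ^ 2 + b * x + c ≠ 0) ∧
    padicValInt 3 (cubicSumNorm 127 ζ 1 b c) = 1 :=
  ⟨107, 1, 3, by decide, by decide, by decide, by
    rw [show cubicSumNorm 127 107 1 1 3 = 3 * ((4 : ℕ) : ℤ) by decide]; exact padicValInt_three_mul_natCast (by norm_num) (by norm_num)⟩

set_option maxRecDepth 40000 in
/-- PROVED (rung, `q = 139`): `ζ = 96`, `x² + x + 2`, counts `(56,46,36)`, `|Σ|² = 300`. [folklore] -/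
theorem cubicClassCountLaw_139 : ∃ ζ b c : ZMod 139, ζ ^ 3 = 1 ∧ ζ ≠ 1 ∧ (∀ x : ZMod 139, x ^ 2 + b * x + c ≠ 0) ∧
    padicValInt 3 (cubicSumNorm 139 ζ 1 b c) = 1 :=
  ⟨96, 1, 2, by decide, by decide, by decide, by
    rw [show cubicSumNorm 139 96 1 1 2 = 3 * ((100 : ℕ) : ℤ) by decide]; exact padicValInt_three_mul_natCast (by norm_num) (by norm_num)⟩

set_option maxRecDepth 40000 in
/-- PROVED (rung, `q = 151`): `ζ = 32`, `x² + x + 3`, counts `(64,36,50)`, `|Σ|² = 588 = 3·14²`. [folklore] -/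
theorem cubicClassCountLaw_151 : ∃ ζ b c : ZMod 151, ζ ^ 3 = 1 ∧ ζ ≠ 1 ∧ (∀ x : ZMod 151, x ^ 2 + b * x + c ≠ 0) ∧
    padicValInt 3 (cubicSumNorm 151 ζ 1 b c) = 1 :=
  ⟨32, 1, 3, by decide, by decide, by decide, by
    rw [show cubicSumNorm 151 32 1 1 3 = 3 * ((196 : ℕ) : ℤ) by decide]; exact padicValInt_three_mul_natCast (by norm_num) (by norm_num)⟩

set_option maxRecDepth 40000 in
/-- PROVED (rung, `q = 157`, `2` a cube): `ζ = 12`, `x² + x + 4`, counts `(60,52,44)`, `|Σ|² = 192`. [folklore] -/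
theorem cubicClassCountLaw_157 : ∃ ζ b c : ZMod 157, ζ ^ 3 = 1 ∧ ζ ≠ 1 ∧ (∀ x : ZMod 157, x ^ 2 + b * x + c ≠ 0) ∧
    padicValInt 3 (cubicSumNorm 157 ζ 1 b c) = 1 :=
  ⟨12, 1, 4, by decide, by decide, by decide, by
    rw [show cubicSumNorm 157 12 1 1 4 = 3 * ((64 : ℕ) : ℤ) by decide]; exact padicValInt_three_mul_natCast (by norm_num) (by norm_num)⟩

/-- **THE COUNT LAW UP TO 157** — `CubicClassCountLawAtThree` restricted to `q ≤ 157`; PROVED below from the seventeen decided rungs (six in the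
CubicSum file, eleven here; the primes `q ≡ 1 (3)` in `(43, 157]` are `61, 67, 73, 79, 97, 103, 109, 127, 139, 151, 157`). [folklore] -/
@[conjecture]
def CubicClassCountLawUpTo157AtThree : Prop :=
    ∀ (q : ℕ) [Fact q.Prime], q % 3 = 1 → q ≤ 157 →
      ∃ ζ b c : ZMod q, ζ ^ 3 = 1 ∧ ζ ≠ 1 ∧ (∀ x : ZMod q, x ^ 2 + b * x + c ≠ 0) ∧
        padicValInt 3 (cubicSumNorm q ζ 1 b c) = 1

/-- PROVED — the count law for every prime `q ≡ 1 (3)`, `q ≤ 157`. [folklore] -/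
theorem cubicClassCountLawUpTo157 : CubicClassCountLawUpTo157AtThree := by
  intro q hF h1 hle
  by_cases h43 : q ≤ 43
  · exact cubicClassCountLawUpTo43 q h1 h43
  have hp : q.Prime := hF.out
  interval_cases q
  all_goals first
    | exact cubicClassCountLaw_61 | exact cubicClassCountLaw_67 | exact cubicClassCountLaw_73 | exact cubicClassCountLaw_79
    | exact cubicClassCountLaw_97 | exact cubicClassCountLaw_103 | exact cubicClassCountLaw_109 | exact cubicClassCountLaw_127
    | exact cubicClassCountLaw_139 | exact cubicClassCountLaw_151 | exact cubicClassCountLaw_157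
    | (exfalso; omega) | (exfalso; norm_num at hp)

end Summit.BirchSwinnertonDyer.BirchSwinnertonDyer.Theorems.CartanCorrespondence
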